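import Mathlib.Algebra.BigOperators.Group.Finset.Sigma
import Mathlib.Analysis.SpecialFunctions.Log.Basic
import Mathlib.Analysis.SpecialFunctions.Log.Deriv
import Mathlib.Analysis.Convex.Jensen
import Mathlib.Analysis.Convex.SpecificFunctions.Basic
import Mathlib.Analysis.Convex.Deriv
import Literature.Combinatorics.SimpleGraph.MooreBoundWalks
import HarnessLib

/-!
# Non-backtracking walk counts (Alon–Hoory–Linial), III: the walk-count inequality

Support for the proof of `alonHooryLinial_mooreBound` (Theorem 1 of [AlonHooryLinial2002]),
the analytic half (p. 55 of the paper): if every non-isolated vertex has degree `≥ 2` then the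
number of non-backtracking walks with `k` further steps satisfies
`Σ_{darts uv} N_{uv,k} ≥ D · (D/n − 1)^k`, `D = Σ_v d_v = 2|E|` (`card_mul_pow_le_dartSum`).
The paper obtains this from the AM–GM inequality over all walks, the stationarity of the uniform
dart distribution for the non-returning random walk, and the log-convexity of `(d−1)^d`
(`Λ ≥ d̄ − 1`).  We prove the same inequality without probability, by the equivalent induction
on `k`: with `Φ = Σ_v d_v log (d_v − 1)` and `L_k = Σ_{darts} log N_{uv,k}`,

* `card_mul_log_add_sum_log_le` — per-vertex AM–GM (concavity of `log`, Mathlib's Jensen);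
* `phi_add_logSum_le`, `mul_phi_le_logSum` — `Φ + L_k ≤ L_{k+1}`, hence `k Φ ≤ L_k`
  (this is where stationarity enters, as the dart-reversal identity);
* `card_mul_exp_le_dartSum` — AM–GM over darts, `D exp (L_k / D) ≤ Σ N_{uv,k}`;
* `convexOn_mul_log_sub_one`, `card_mul_log_le_phi` — convexity of `x log (x−1)` on `[2,∞)`
  (via the monotone derivative `log (x−1) + x/(x−1)`) and Jensen: `D log (D/n − 1) ≤ Φ`.

## References

* N. Alon, S. Hoory, N. Linial, The Moore bound for irregular graphs, *Graphs Combin.* 18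
  (2002) 53–57 [AlonHooryLinial2002].
-/

namespace Literature.Combinatorics.SimpleGraph.AlonHooryLinial

open _root_.SimpleGraph Finset

section Analytic

open Real

/-- Per-vertex arithmetic–geometric mean step: for positive reals `a_w` indexed by a set `T` with
`|T| ≥ 2`, `Σ_{u ∈ T} log (Σ_{w ∈ T ∖ {u}} a_w) ≥ |T| log (|T| − 1) + Σ_{w ∈ T} log a_w`
(concavity of `log`). [folklore] -/
theorem card_mul_log_add_sum_log_le {ι : Type*} [DecidableEq ι] (T : Finset ι) (a : ι → ℝ)
    (ha : ∀ w ∈ T, 0 < a w) (hT : 2 ≤ T.card) :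
    (T.card : ℝ) * log (T.card - 1) + ∑ w ∈ T, log (a w)
      ≤ ∑ u ∈ T, log (∑ w ∈ T.erase u, a w) := by
  set d : ℝ := (T.card : ℝ) with hd
  have hd1 : (0 : ℝ) < d - 1 := by
    have : (2 : ℝ) ≤ d := by rw [hd]; exact_mod_cast hT
    linarith
  have key : ∀ u ∈ T,
      log (d - 1) + (d - 1)⁻¹ * ∑ w ∈ T.erase u, log (a w) ≤ log (∑ w ∈ T.erase u, a w) := by
    intro u hu
    have hcard : ((T.erase u).card : ℝ) = d - 1 := by
      rw [card_erase_of_mem hu, Nat.cast_sub (by omega), Nat.cast_one]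
    have hpos : 0 < ∑ w ∈ T.erase u, a w := by
      refine sum_pos (fun w hw => ha w (mem_of_mem_erase hw)) ?_
      rw [← card_pos]
      have : ((T.erase u).card : ℝ) > 0 := by rw [hcard]; exact hd1
      exact_mod_cast this
    have hJ := (strictConcaveOn_log_Ioi.concaveOn).le_map_sum (t := T.erase u)
      (w := fun _ => (d - 1)⁻¹) (p := a) (fun _ _ => inv_nonneg.2 hd1.le)
      (by rw [sum_const, nsmul_eq_mul, hcard, mul_inv_cancel₀ hd1.ne'])
      (fun w hw => ha w (mem_of_mem_erase hw))
    simp only [smul_eq_mul] at hJ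
    rw [← mul_sum, ← mul_sum, log_mul (inv_ne_zero hd1.ne') hpos.ne', log_inv] at hJ
    linarith
  have hsum := sum_le_sum key
  rw [sum_add_distrib, sum_const, nsmul_eq_mul, ← mul_sum] at hsum
  have hdouble : ∑ u ∈ T, ∑ w ∈ T.erase u, log (a w) = (d - 1) * ∑ w ∈ T, log (a w) := by
    rw [sum_congr rfl fun u hu => sum_erase_eq_sub (f := fun w => log (a w)) hu, sum_sub_distrib,
      sum_const, nsmul_eq_mul, hd]
    ring
  rw [hdouble, ← mul_assoc, inv_mul_cancel₀ hd1.ne', one_mul] at hsum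
  rw [hd] at hsum ⊢
  exact hsum

/-- `x ↦ x log (x − 1)` is convex on `[2, ∞)` (its derivative `log (x−1) + x/(x−1)` is monotone
there); this is the log-convexity of `(d−1)^d` used by Alon–Hoory–Linial.
[cite: AlonHooryLinial2002, §proof of Thm 1, p. 55] -/
theorem convexOn_mul_log_sub_one : ConvexOn ℝ (Set.Ici (2 : ℝ)) (fun x : ℝ => x * log (x - 1)) := by
  have hderiv : ∀ x : ℝ, 1 < x →
      HasDerivAt (fun x : ℝ => x * log (x - 1)) (log (x - 1) + x * (x - 1)⁻¹) x := by
    intro x hx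
    have h1 : HasDerivAt (fun y : ℝ => y - 1) 1 x := (hasDerivAt_id x).sub_const 1
    have h2 : HasDerivAt (fun y : ℝ => log (y - 1)) (1 / (x - 1)) x := h1.log (by linarith)
    have h3 : HasDerivAt (fun y : ℝ => y * log (y - 1)) (1 * log (x - 1) + x * (1 / (x - 1))) x :=
      (hasDerivAt_id' x).mul h2
    convert h3 using 1
    ring
  refine MonotoneOn.convexOn_of_deriv (convex_Ici 2) ?_ ?_ ?_
  · refine continuousOn_id.mul (ContinuousOn.log (continuousOn_id.sub continuousOn_const) ?_)
    intro x hx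
    simp only [Set.mem_Ici] at hx
    show x - 1 ≠ 0
    linarith
  · rw [interior_Ici]
    intro x hx
    simp only [Set.mem_Ioi] at hx
    exact (hderiv x (by linarith)).differentiableAt.differentiableWithinAt
  · rw [interior_Ici]
    intro x hx y hy hxy
    simp only [Set.mem_Ioi] at hx hy
    rw [(hderiv x (by linarith)).deriv, (hderiv y (by linarith)).deriv]
    have ha : 0 < x - 1 := by linarith
    have hb : 0 < y - 1 := by linarith
    have hlog : 1 - (x - 1) / (y - 1) ≤ log (y - 1) - log (x - 1) := by
      rw [← log_div hb.ne' ha.ne']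
      have := one_sub_inv_le_log_of_pos (div_pos hb ha)
      rwa [inv_div] at this
    have e1 : x * (x - 1)⁻¹ = 1 + (x - 1)⁻¹ := by field_simp; ring
    have e2 : y * (y - 1)⁻¹ = 1 + (y - 1)⁻¹ := by field_simp; ring
    have key : (1 - (x - 1) / (y - 1)) - ((x - 1)⁻¹ - (y - 1)⁻¹)
        = (x - 2) * (y - x) / ((x - 1) * (y - 1)) := by
      field_simp
      ring
    have hnn : 0 ≤ (x - 2) * (y - x) / ((x - 1) * (y - 1)) :=
      div_nonneg (mul_nonneg (by linarith) (by linarith)) (mul_pos ha hb).le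
    rw [e1, e2]
    linarith

variable {V : Type*} [Fintype V] [DecidableEq V] {H : _root_.SimpleGraph V}
  [DecidableRel H.Adj]

/-- One step of the product (here: log-sum) inequality: with `Φ = Σ_v d_v log (d_v − 1)` and
`L_k = Σ_{darts uv} log N_{uv,k}`, we have `Φ + L_k ≤ L_{k+1}` (per-vertex AM–GM plus dart
reversal). [cite: AlonHooryLinial2002, §proof of Thm 1, p. 55] -/
theorem phi_add_logSum_le (h2 : ∀ v, 0 < H.degree v → 2 ≤ H.degree v) (k : ℕ) :
    (∑ v, (H.degree v : ℝ) * log ((H.degree v : ℝ) - 1))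
      + ∑ v, ∑ u ∈ H.neighborFinset v, log (nbCount H k u v : ℝ)
      ≤ ∑ v, ∑ u ∈ H.neighborFinset v, log (nbCount H (k + 1) u v : ℝ) := by
  rw [sum_neighborFinset_comm (fun u v => log (nbCount H k u v : ℝ)), ← sum_add_distrib]
  refine sum_le_sum fun v _ => ?_
  simp_rw [nbCount_succ, Nat.cast_sum]
  rcases Nat.eq_zero_or_pos (H.degree v) with h0 | hpos
  · have hN : H.neighborFinset v = ∅ := by
      rw [← card_eq_zero, card_neighborFinset_eq_degree, h0]
    simp [hN, h0]
  · have := card_mul_log_add_sum_log_le (H.neighborFinset v) (fun w => (nbCount H k v w : ℝ))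
      (fun w hw => by exact_mod_cast nbCount_pos h2 k ((mem_neighborFinset ..).1 hw))
      (by rw [card_neighborFinset_eq_degree]; exact h2 v hpos)
    rw [card_neighborFinset_eq_degree] at this
    exact this

/-- Iterating `phi_add_logSum_le`: `k Φ ≤ L_k`.
[cite: AlonHooryLinial2002, §proof of Thm 1, p. 55] -/
theorem mul_phi_le_logSum (h2 : ∀ v, 0 < H.degree v → 2 ≤ H.degree v) (k : ℕ) :
    (k : ℝ) * (∑ v, (H.degree v : ℝ) * log ((H.degree v : ℝ) - 1))
      ≤ ∑ v, ∑ u ∈ H.neighborFinset v, log (nbCount H k u v : ℝ) := by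
  induction k with
  | zero => simp
  | succ k ih =>
    have := phi_add_logSum_le h2 k
    push_cast
    linarith

/-- AM–GM over all darts: `D · exp (L_k / D) ≤ Σ_{darts} N_{uv,k}` where `D = Σ_v d_v` is the
number of darts. [cite: AlonHooryLinial2002, §proof of Thm 1, p. 55] -/
theorem card_mul_exp_le_dartSum (h2 : ∀ v, 0 < H.degree v → 2 ≤ H.degree v) (k : ℕ)
    (hD : 0 < ∑ v, (H.degree v : ℝ)) :
    (∑ v, (H.degree v : ℝ)) *
        exp ((∑ v, ∑ u ∈ H.neighborFinset v, log (nbCount H k u v : ℝ)) / ∑ v, (H.degree v : ℝ))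
      ≤ ∑ v, ∑ u ∈ H.neighborFinset v, (nbCount H k u v : ℝ) := by
  set D := ∑ v, (H.degree v : ℝ) with hDdef
  set T := (univ : Finset V).sigma fun v => H.neighborFinset v with hTdef
  have hT : (T.card : ℝ) = D := by
    rw [hTdef, card_sigma, hDdef, Nat.cast_sum]
    simp
  have hJ := (convexOn_exp).map_sum_le (t := T) (w := fun _ => D⁻¹)
    (p := fun x => log (nbCount H k x.2 x.1 : ℝ)) (fun _ _ => inv_nonneg.2 hD.le)
    (by rw [sum_const, nsmul_eq_mul, hT, mul_inv_cancel₀ hD.ne']) (fun _ _ => Set.mem_univ _)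
  simp only [smul_eq_mul] at hJ
  rw [← mul_sum, ← mul_sum, hTdef, sum_sigma, sum_sigma] at hJ
  have hexp : ∑ v, ∑ u ∈ H.neighborFinset v, exp (log (nbCount H k u v : ℝ))
      = ∑ v, ∑ u ∈ H.neighborFinset v, (nbCount H k u v : ℝ) :=
    sum_congr rfl fun v _ => sum_congr rfl fun u hu =>
      exp_log (by exact_mod_cast nbCount_pos h2 k ((mem_neighborFinset ..).1 hu).symm)
  rw [hexp, inv_mul_eq_div, inv_mul_eq_div, le_div_iff₀ hD] at hJ
  linarith

omit [DecidableEq V] in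
/-- Jensen for `x log (x−1)`: `D log (D/|S| − 1) ≤ Φ` when every vertex of `S` has degree `≥ 2`
and `S` contains all non-isolated vertices. [cite: AlonHooryLinial2002, §proof of Thm 1, p. 55] -/
theorem card_mul_log_le_phi (S : Finset V) (hS : ∀ v, 0 < H.degree v → v ∈ S)
    (h2 : ∀ v ∈ S, 2 ≤ H.degree v) (hSne : S.Nonempty) :
    (∑ v, (H.degree v : ℝ)) * log ((∑ v, (H.degree v : ℝ)) / S.card - 1)
      ≤ ∑ v, (H.degree v : ℝ) * log ((H.degree v : ℝ) - 1) := by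
  have hdeg0 : ∀ v, v ∉ S → H.degree v = 0 := fun v hv => by
    by_contra h
    exact hv (hS v (Nat.pos_of_ne_zero h))
  have hsumS : ∑ v ∈ S, (H.degree v : ℝ) = ∑ v, (H.degree v : ℝ) :=
    sum_subset (subset_univ _) fun v _ hv => by simp [hdeg0 v hv]
  have hphiS : ∑ v ∈ S, (H.degree v : ℝ) * log ((H.degree v : ℝ) - 1)
      = ∑ v, (H.degree v : ℝ) * log ((H.degree v : ℝ) - 1) :=
    sum_subset (subset_univ _) fun v _ hv => by simp [hdeg0 v hv]
  set s : ℝ := (S.card : ℝ) with hsdef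
  have hs : 0 < s := by rw [hsdef]; exact_mod_cast hSne.card_pos
  have hJ := convexOn_mul_log_sub_one.map_sum_le (t := S) (w := fun _ => s⁻¹)
    (p := fun v => (H.degree v : ℝ)) (fun _ _ => inv_nonneg.2 hs.le)
    (by rw [sum_const, nsmul_eq_mul, hsdef, mul_inv_cancel₀ hs.ne'])
    (fun v hv => show (2 : ℝ) ≤ _ by exact_mod_cast h2 v hv)
  simp only [smul_eq_mul] at hJ
  rw [← mul_sum, ← mul_sum, hsumS, hphiS, inv_mul_eq_div, inv_mul_eq_div, le_div_iff₀ hs] at hJ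
  set D := ∑ v, (H.degree v : ℝ)
  calc D * log (D / s - 1) = D / s * log (D / s - 1) * s := by field_simp
    _ ≤ _ := hJ

/-- **The non-backtracking walk count bound** (the inequality `N_l ≥ Λ^l ≥ (d̄ − 1)^l` of
Alon–Hoory–Linial): if every vertex of `S` has degree `≥ 2` and `S` contains every non-isolated
vertex, then `Σ_{darts uv} N_{uv,k} ≥ D (D/|S| − 1)^k`, where `D = Σ_v d_v = 2|E|`.
[cite: AlonHooryLinial2002, §proof of Thm 1, p. 55] -/
theorem card_mul_pow_le_dartSum (S : Finset V) (hS : ∀ v, 0 < H.degree v → v ∈ S)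
    (h2 : ∀ v ∈ S, 2 ≤ H.degree v) (hSne : S.Nonempty) (k : ℕ) :
    (∑ v, (H.degree v : ℝ)) * ((∑ v, (H.degree v : ℝ)) / S.card - 1) ^ k
      ≤ ∑ v, ∑ u ∈ H.neighborFinset v, (nbCount H k u v : ℝ) := by
  have h2' : ∀ v, 0 < H.degree v → 2 ≤ H.degree v := fun v hv => h2 v (hS v hv)
  have hdeg0 : ∀ v, v ∉ S → H.degree v = 0 := fun v hv => by
    by_contra h
    exact hv (hS v (Nat.pos_of_ne_zero h))
  set D := ∑ v, (H.degree v : ℝ) with hDdef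
  set s : ℝ := (S.card : ℝ) with hsdef
  have hs : 0 < s := by rw [hsdef]; exact_mod_cast hSne.card_pos
  have hDs : 2 * s ≤ D := by
    have : ∑ v ∈ S, (H.degree v : ℝ) = D :=
      sum_subset (subset_univ _) fun v _ hv => by simp [hdeg0 v hv]
    rw [← this, hsdef]
    have : ∑ v ∈ S, (2 : ℝ) ≤ ∑ v ∈ S, (H.degree v : ℝ) :=
      sum_le_sum fun v hv => by exact_mod_cast h2 v hv
    rw [sum_const, nsmul_eq_mul] at this
    linarith
  have hD : 0 < D := by linarith
  have ht : 1 ≤ D / s - 1 := by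
    rw [le_sub_iff_add_le, le_div_iff₀ hs]
    linarith
  set L := ∑ v, ∑ u ∈ H.neighborFinset v, log (nbCount H k u v : ℝ)
  set Φ := ∑ v, (H.degree v : ℝ) * log ((H.degree v : ℝ) - 1)
  have h1 : D * (D / s - 1) ^ k ≤ D * exp (L / D) := by
    refine mul_le_mul_of_nonneg_left ?_ hD.le
    rw [← exp_log (pow_pos (by linarith) k), exp_le_exp, log_pow]
    have hΦ : D * log (D / s - 1) ≤ Φ := card_mul_log_le_phi S hS h2 hSne
    have hL : (k : ℝ) * Φ ≤ L := mul_phi_le_logSum h2' k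
    rw [le_div_iff₀ hD]
    calc (k : ℝ) * log (D / s - 1) * D = k * (D * log (D / s - 1)) := by ring
      _ ≤ k * Φ := mul_le_mul_of_nonneg_left hΦ (Nat.cast_nonneg k)
      _ ≤ L := hL
  exact h1.trans (card_mul_exp_le_dartSum h2' k hD)

end Analytic

end Literature.Combinatorics.SimpleGraph.AlonHooryLinial
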